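import Mathlib
import Summits.Ventures.PercRepro2.SwOutSevDefs
import Summits.Ventures.PercRepro2.SwOutSevPieces
import Summits.Ventures.PercRepro2.SwOutSevBase

/-!
# A core-kind point is the uniform realisation of its re-typed base; the block inequality of its
data (blind cell PercRepro2, night-4 g22, 2026-08-27; proofs/NIGHT4-G22.md §2)

`qOfR ζ` is the point of the raw cube of the data of `ζ` read off its red side (every arm set on
the red side gets `true`; a mixed arm gives `a = uP = e`, so `qOfR ζ` is a CORE point); `ζ` is its
realisation at the canonical base (**`mixedRealR_coreBaseOf_R`**: the flipped classes of `qOfR ζ`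
are exactly the edges touching the blue side).  A core point does not leak (`not_leak_of_core`);
hence, by the red and blue hull formulas of the several-arms base, `u ∈ hull ζ h` forces a u-arm
or an absorbed arm (**`nonempty_ι_of_coreKind`**), and the block theorem
`MixedBaseR.rigid_block_plus` applies to the data of every core-kind `Q`-point
(**`card_blockR_le`**: the rigid inequality on `blockR (mixedDataR ζ) ∩ Q` for every up-set).
-/

namespace Summit.Ventures.PercRepro2

namespace MixedArms

open Hull LocRows BigBlock

variable {V : Type*} {E : Type*} [Fintype E] [DecidableEq E]

open scoped Classical

variable {ends : E → Sym2 V} {ρ : Type*} [Fintype ρ] {U : Set V} {ξ : Config E} {l h o u : V}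
  {p : ρ → V}

section Core

variable {ι ρ' ν κ : Type*}

omit [Fintype E] [DecidableEq E] [Fintype ρ] in
/-- A core point has no red-side leak. -/
lemma not_leakRR_of_core {arm : ν → ρ'} {q : PtR ι ρ' ν κ} (hq : Core q arm) :
    ¬ LeakRR arm q := by
  rintro ⟨-, r, hr, he | ⟨i, hi, ha⟩⟩
  · rw [← hq.2 r] at he
    rw [hr] at he
    exact Bool.noConfusion he
  · rw [hq.1 i, hi, hr] at ha
    exact Bool.noConfusion ha

omit [Fintype E] [DecidableEq E] [Fintype ρ] in
/-- The flip of a core point is a core point. -/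
lemma core_flipPt {arm : ν → ρ'} {q : PtR ι ρ' ν κ} (hq : Core q arm) : Core (flipPt q) arm := by
  refine ⟨fun i => ?_, fun r => ?_⟩
  · show (!q.2.1 i) = !q.2.2.1 (arm i)
    rw [hq.1 i]
  · show (!q.2.2.1 r) = !q.2.2.2.1 r
    rw [hq.2 r]

omit [Fintype E] [DecidableEq E] [Fintype ρ] in
/-- A core point has no blue-side leak. -/
lemma not_leakBR_of_core {arm : ν → ρ'} {q : PtR ι ρ' ν κ} (hq : Core q arm) :
    ¬ LeakBR arm q := not_leakRR_of_core (core_flipPt hq)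

omit [Fintype E] [DecidableEq E] [Fintype ρ] in
/-- A core point does not leak. -/
lemma not_leak_of_core' {arm : ν → ρ'} {q : PtR ι ρ' ν κ} (hq : Core q arm) : ¬ Leak q arm :=
  not_leak_iff_RB.2 ⟨not_leakRR_of_core hq, not_leakBR_of_core hq⟩

end Core

section QOf

variable (ends h u p)

/-- The raw-cube point of a core-kind configuration: the arm sets on its red side. -/
noncomputable def qOfR (ζ : Config E) :
    PtR (mixedDataR ends h u p ζ).ι (mixedDataR ends h u p ζ).ρ' (mixedDataR ends h u p ζ).ν
      (mixedDataR ends h u p ζ).κ :=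
  (fun j => decide ((mixedDataR ends h u p ζ).U j ⊆ redExt ends h u ζ),
    fun i => decide (armC ends h u ζ (p i.1.1) ⊆ redExt ends h u ζ),
    fun r => decide (armC ends h u ζ (p r.1) ⊆ redExt ends h u ζ),
    fun r => decide (armC ends h u ζ (p r.1) ⊆ redExt ends h u ζ),
    fun k => decide ((mixedDataR ends h u p ζ).F k ⊆ redExt ends h u ζ))

variable {ends h u p}

omit [DecidableEq E] in
/-- `qOfR ζ` is a core point. -/
lemma core_qOfR (ζ : Config E) : Core (qOfR ends h u p ζ) (mixedDataR ends h u p ζ).arm :=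
  ⟨fun _ => rfl, fun _ => rfl⟩

end QOf

section Real

variable (hj : MixedJunctionR ends U h u p o)
include hj

omit [Fintype E] [DecidableEq E] [Fintype ρ] in
/-- A neighbour of `p r` inside the extended hull lies in its h-piece. -/
lemma mem_AhOfR_of_edge_p {ζ : Config E} {r : ρ} {e : E} {x : V} (hxe : ends e = s(p r, x))
    (hxH : x ∈ extHull ends ζ h u) (hxu : x ≠ u) : x ∈ AhOfR ends h u p ζ r := by
  have hxp : x ≠ p r := fun h' => hj.hloop_p r e (by rw [hxe, h'])
  have hxh : x ≠ h := fun h' => hj.hnadj_p r e (by rw [hxe, h', Sym2.eq_swap])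
  exact ⟨mem_armC_of_edge (mem_armC_self (p r)) (p_mem_extHull (hj.hup r) ζ) (hj.hne_hp r).symm
    (hj.hne_up r).symm hxH hxh hxu hxe, hxp⟩

/-- **A core-kind point is the realisation of the core point `qOfR ζ` of its re-typed base.** -/
theorem mixedRealR_coreBaseOf_R (hl : l ∉ U) {ζ : Config E} (hζ : ζ ∈ swOutSide ends l h o U ξ)
    (hk : CoreKind ends U h u ζ) :
    mixedRealR ends u (mixedDataR ends h u p ζ).U ((mixedDataR ends h u p ζ).drop p)
      (mixedDataR ends h u p ζ).Ah (mixedDataR ends h u p ζ).F (coreBaseOf ends ζ h u)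
      (qOfR ends h u p ζ) = ζ := by
  have hhu := hj.hne_hu
  have hdisj : ∀ x, x ∈ redExt ends h u ζ → x ∈ blueExt ends ζ h u → False :=
    fun x hxR hxB => redExt_disjoint_blueExt hl hj.hout hζ hk x hxR hxB
  have hnoRB : ∀ e x y, ends e = s(x, y) → x ∈ redExt ends h u ζ → y ∈ blueExt ends ζ h u →
      False := fun e x y hxy hx hy => no_edge_redExt_blueExt hdisj hxy hx hy
  have hHU : extHull ends ζ h u ⊆ U := extHull_subset_of_coreKind hζ hk
  have hAP : ∀ r, armC ends h u ζ (p r) ∈ armsC ends h u ζ := armP_mem_armsC_R hj ζ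
  have hpP : ∀ r, p r ∈ armC ends h u ζ (p r) := fun r => mem_armC_self (p r)
  set d := mixedDataR ends h u p ζ with hd
  -- an arm is on the blue side iff it is not on the red side
  have hside : ∀ P ∈ armsC ends h u ζ, ¬ P ⊆ redExt ends h u ζ ↔ P ⊆ blueExt ends ζ h u := by
    intro P hP
    obtain ⟨y, hy⟩ := armsC_nonempty hP
    constructor
    · intro hnot
      rcases armsC_subset_side hnoRB hP with hPR | hPB
      · exact absurd hPR hnot
      · exact hPB
    · intro hPB hPR
      exact hdisj y (hPR hy) (hPB hy)
  have hUmem : ∀ j : d.ι, d.U j ∈ armsC ends h u ζ := by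
    rintro (⟨P, hP⟩ | ⟨x, hx⟩)
    · exact (mem_uArmsR_iff.1 hP).1
    · obtain ⟨-, hx2⟩ := mem_absArmsR_iff.1 hx
      show x.2 ∈ armsC ends h u ζ
      rw [hx2]; exact hAP x.1
  have hAhsub : ∀ i : d.ν, d.Ah i ⊆ AhOfR ends h u p ζ i.1.1 := by
    intro i
    obtain ⟨-, y, hy, hi⟩ := exists_pieceC_of_mem_piecesR (Finset.mem_filter.1 i.2).1
    show i.1.2 ⊆ _
    rw [hi]; exact pieceC_subset hy
  have hFmem : ∀ k : d.κ, d.F k ∈ armsC ends h u ζ := fun k => (mem_farArmsR_iff.1 k.2).1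
  -- the flipped classes of `qOfR ζ` are exactly the edges touching the blue side
  have key : ∀ e, e ∈ flipSetR ends u d.U (d.drop p) d.Ah d.F (qOfR ends h u p ζ) ↔
      e ∈ touches ends (blueExt ends ζ h u) := by
    intro e
    constructor
    · rintro ((((⟨j, hj', x, hx, y, hxy⟩ | ⟨i, hi, x, hx, y, hxy⟩) | ⟨r, hr, hup⟩) |
        ⟨r, hr, z, hpz, -, -⟩) | ⟨k, hk, x, hx, y, hxy⟩)
      · simp only [qOfR, decide_eq_false_iff_not] at hj'
        exact ⟨x, ((hside _ (hUmem j)).1 hj') hx, y, hxy⟩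
      · simp only [qOfR, decide_eq_false_iff_not] at hi
        exact ⟨x, ((hside _ (hAP i.1.1)).1 hi) (hAhsub i hx).1, y, hxy⟩
      · simp only [qOfR, decide_eq_false_iff_not] at hr
        exact ⟨p r.1, ((hside _ (hAP r.1)).1 hr) (hpP r.1), u, ends_swap hup⟩
      · simp only [qOfR, decide_eq_false_iff_not] at hr
        exact ⟨p r.1, ((hside _ (hAP r.1)).1 hr) (hpP r.1), z, hpz⟩
      · simp only [qOfR, decide_eq_false_iff_not] at hk
        exact ⟨x, ((hside _ (hFmem k)).1 hk) hx, y, hxy⟩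
    · rintro ⟨x, hxB, y, hxy⟩
      have hxH := blueExt_subset_extHull hxB
      obtain ⟨_, hxh, hxu⟩ := mem_blueExt_iff.1 hxB
      obtain ⟨P, hP, hxP⟩ := exists_armsC_of_mem hhu hxH hxh hxu
      have hnotR : ¬ P ⊆ redExt ends h u ζ := fun hPR => hdisj x (hPR hxP) hxB
      by_cases hPp : ∃ r, P = armC ends h u ζ (p r)
      · obtain ⟨r, rfl⟩ := hPp
        have hc : decide (armC ends h u ζ (p r) ⊆ redExt ends h u ζ) = false := by
          simp only [decide_eq_false_iff_not]; exact hnotR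
        by_cases hr : DeadBlueR ends h u p ζ r
        · -- a mixed arm
          have hrm : r ∈ mixedR ends h u p ζ := mem_mixedR_iff.2 hr
          by_cases hxp : x = p r
          · rw [hxp] at hxy
            by_cases hyu : y = u
            · subst hyu
              exact Or.inl (Or.inl (Or.inr ⟨⟨r, hrm⟩, hc, ends_swap hxy⟩))
            by_cases hyA : y ∈ AhOfR ends h u p ζ r
            · have hmem : (r, pieceC ends h u p ζ r y) ∈
                  (piecesR ends h u p ζ).filter fun x => x.1 ∈ mixedR ends h u p ζ :=
                Finset.mem_filter.2 ⟨mem_piecesR_of_mem_AhOfR' hr hyA, hrm⟩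
              exact Or.inl (Or.inl (Or.inl (Or.inr ⟨(⟨(r, pieceC ends h u p ζ r y), hmem⟩ : d.ν),
                hc, y, mem_pieceC_self y, p r, ends_swap hxy⟩)))
            · refine Or.inl (Or.inr ⟨⟨r, hrm⟩, hc, y, hxy, hyu, ?_⟩)
              intro i hyi
              have hyA' := hAhsub i hyi
              have hyH : y ∈ extHull ends ζ h u := (armsC_subset (hAP i.1.1) y hyA'.1).1
              exact hyA (mem_AhOfR_of_edge_p hj hxy hyH hyu)
          · have hxA : x ∈ AhOfR ends h u p ζ r := ⟨hxP, hxp⟩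
            have hmem : (r, pieceC ends h u p ζ r x) ∈
                (piecesR ends h u p ζ).filter fun x => x.1 ∈ mixedR ends h u p ζ :=
              Finset.mem_filter.2 ⟨mem_piecesR_of_mem_AhOfR' hr hxA, hrm⟩
            exact Or.inl (Or.inl (Or.inl (Or.inr ⟨(⟨(r, pieceC ends h u p ζ r x), hmem⟩ : d.ν),
              hc, x, mem_pieceC_self x, y, hxy⟩)))
        · -- an absorbed arm
          have hmem : (r, armC ends h u ζ (p r)) ∈ absArmsR ends h u p ζ :=
            mem_absArmsR_iff.2 ⟨hr, rfl⟩
          refine Or.inl (Or.inl (Or.inl (Or.inl ⟨Sum.inr ⟨(r, armC ends h u ζ (p r)), hmem⟩, ?_,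
            x, hxP, y, hxy⟩)))
          simp only [qOfR, decide_eq_false_iff_not]; exact hnotR
      have hPp' : ∀ r, P ≠ armC ends h u ζ (p r) := fun r hr => hPp ⟨r, hr⟩
      by_cases hadj : ∃ e x, ends e = s(u, x) ∧ x ∈ P
      · have hPu : P ∈ uArmsR ends h u p ζ := mem_uArmsR_iff.2 ⟨hP, hPp', hadj⟩
        refine Or.inl (Or.inl (Or.inl (Or.inl ⟨Sum.inl ⟨P, hPu⟩, ?_, x, hxP, y, hxy⟩)))
        simp only [qOfR, decide_eq_false_iff_not]; exact hnotR
      · have hPf : P ∈ farArmsR ends h u p ζ := mem_farArmsR_iff.2 ⟨hP, hPp', hadj⟩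
        refine Or.inr ⟨⟨P, hPf⟩, ?_, x, hxP, y, hxy⟩
        simp only [qOfR, decide_eq_false_iff_not]; exact hnotR
  funext e
  unfold mixedRealR coreBaseOf
  by_cases he : e ∈ touches ends (blueExt ends ζ h u)
  · rw [if_pos ((key e).2 he), flip_apply_of_mem he, Bool.not_not]
  · rw [if_neg (fun h' => he ((key e).1 h')), flip_apply_of_notMem he]

/-- **A core-kind point has a u-arm or an absorbed arm** (`u` reaches `h` through one of them). -/
theorem nonempty_ι_of_coreKind (hl : l ∉ U) {ζ : Config E} (hζ : ζ ∈ swOutSide ends l h o U ξ)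
    (hk : CoreKind ends U h u ζ) : Nonempty (mixedDataR ends h u p ζ).ι := by
  by_contra hne
  rw [not_nonempty_iff] at hne
  have hb := mixedBaseR_of_coreKindR hj hl hζ hk
  have hq := core_qOfR (ends := ends) (h := h) (u := u) (p := p) ζ
  have hζ' := mixedRealR_coreBaseOf_R hj hl hζ hk
  have hu := hk.1
  rw [← hζ'] at hu
  have hup : ∀ r : (mixedDataR ends h u p ζ).ρ', ∃ e, ends e = s(u, (mixedDataR ends h u p ζ).drop p r) :=
    fun r => hj.hup r.1
  have hno : ∀ q' : PtR (mixedDataR ends h u p ζ).ι (mixedDataR ends h u p ζ).ρ'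
      (mixedDataR ends h u p ζ).ν (mixedDataR ends h u p ζ).κ,
      u ∉ redSetR h u (mixedDataR ends h u p ζ).U ((mixedDataR ends h u p ζ).drop p)
        (mixedDataR ends h u p ζ).Ah (mixedDataR ends h u p ζ).F q' := by
    intro q' hu'
    rw [mem_redSetR_iff] at hu'
    rcases hu' with hu' | ⟨j, _, _⟩ | ⟨_, j, _⟩ | ⟨r, hu', _⟩ | ⟨i, _, hu'⟩ | ⟨k, _, hu'⟩
    · exact hj.hne_hu hu'.symm
    · exact hne.elim j
    · exact hne.elim j
    · exact hj.hne_up r.1 hu'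
    · exact hb.u_notMem_Ah i hu'
    · exact hb.u_notMem_F k hu'
  rcases hu with hu | hu
  · rw [hb.cluster_mixedRealR hup (not_leakRR_of_core hq)] at hu
    exact hno _ hu
  · rw [hb.cluster_blue_mixedRealR hup (not_leakBR_of_core hq)] at hu
    exact hno _ hu

/-- **The block inequality of the data of a core-kind `Q`-point**: the rigid counting inequality
on `blockR (mixedDataR ζ) ∩ Q` for every up-set of edge sets, from the block theorem
`MixedBaseR.rigid_block_plus` of the re-typed base. -/
theorem card_blockR_le (hl : l ∉ U) {ζ : Config E} (hζ : ζ ∈ swOutSide ends l h o U ξ)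
    (hk : CoreKind ends U h u ζ) {𝓔 : Set (Set E)} (h𝓔 : IsUpperSet 𝓔) :
    ((blockR ends u p (mixedDataR ends h u p ζ)).filter fun ζ' =>
        ζ' ∈ (tgtU ends l h {S : Set V | o ∈ S} : Set (Config E)) ∧ redEdges ends ζ' h ∈ 𝓔).card ≤
      ((blockR ends u p (mixedDataR ends h u p ζ)).filter fun ζ' =>
        ζ' ∈ (tgtU ends l h {S : Set V | o ∈ S} : Set (Config E)) ∧
          blueEdges ends ζ' h ∈ 𝓔).card := by
  haveI := nonempty_ι_of_coreKind hj hl hζ hk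
  have hb := mixedBaseR_of_coreKindR hj hl hζ hk
  have hHU : extHull ends ζ h u ⊆ U := extHull_subset_of_coreKind hζ hk
  set d := mixedDataR ends h u p ζ with hd
  have hAP : ∀ r, armC ends h u ζ (p r) ∈ armsC ends h u ζ := armP_mem_armsC_R hj ζ
  have hup : ∀ r : d.ρ', ∃ e, ends e = s(u, d.drop p r) := fun r => hj.hup r.1
  have hAe : ∀ i : d.ν, ∃ e, e ∈ touches ends (d.Ah i) := by
    intro i
    obtain ⟨-, y, hy, hi⟩ := exists_pieceC_of_mem_piecesR (Finset.mem_filter.1 i.2).1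
    obtain ⟨e, y', hey', hy', hyy'⟩ := exists_dead_of_mem_AhOfR hy
    refine ⟨e, y', ?_, p i.1.1, ends_swap hey'⟩
    show y' ∈ i.1.2
    rw [hi, pieceC_eq_of_mem hyy']
    exact mem_pieceC_self y'
  have hFe : ∀ k : d.κ, ∃ e, e ∈ touches ends (d.F k) := by
    intro k
    obtain ⟨e, he, hP⟩ := Finset.mem_image.1 (mem_farArmsR_iff.1 k.2).1
    obtain ⟨y, hy, -, -, -, harm⟩ := exists_of_mem_junctionEdges he
    have hyP : y ∈ d.F k := by
      show y ∈ k.1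
      rw [← hP, harm]
      exact mem_armC_self y
    rcases hy with hy | hy
    · exact ⟨e, y, hyP, h, ends_swap hy⟩
    · exact ⟨e, y, hyP, u, ends_swap hy⟩
  have huU : u ∈ U := hk.2 (Or.inl (mem_cluster_self _ _ _))
  have hext : ∀ r : d.ρ', ∃ e, e ∈ clsExtR ends u (d.drop p) d.Ah r := by
    intro r
    obtain ⟨e, y, hey, hyU⟩ :=
      exists_ext_edge_R hj (fun r => hHU (p_mem_extHull (hj.hup r) ζ)) r.1
    refine ⟨e, y, hey, fun h' => hyU (h' ▸ huU), fun i hyi => ?_⟩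
    exact hyU (hHU (mem_extHull_of_mem_armsAllR hj (Or.inl (Or.inr (Set.mem_iUnion.2 ⟨i, hyi⟩)))).1)
  have hUs : {h} ∪ {u} ∪ Set.range (d.drop p) ∪ armsAllR d.U d.Ah d.F ⊆ U := by
    rintro x (((rfl | rfl) | ⟨r, rfl⟩) | hx)
    · exact (mem_outClass.1 (mem_swOutSide.1 hζ).2).2 (Or.inl (mem_cluster_self _ _ _))
    · exact huU
    · exact hHU (p_mem_extHull (hj.hup r.1) ζ)
    · exact hHU (mem_extHull_of_mem_armsAllR hj hx).1
  exact hb.rigid_block_plus hup hAe hFe hext hUs hl h𝓔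

end Real

end MixedArms

end Summit.Ventures.PercRepro2
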